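import Summits.HodgeConjecture.HodgeConjecture.Theorems.F0D9opRoad2BodyDesk   -- ★ previous part of the same Lines workfile `F0D9opRoad2Body` (size-lint split ×4)
import HarnessLib

/-!
# `F0D9opRoad2BodyGamma` — ★ RE-HOME of `Lines/F0D9opRoad2Body.lean`, PART 3 of 4 (size-lint split; cut at a declaration boundary).

See PART 1 `Theorems/F0D9opRoad2BodyLetters.lean` for the full re-home header and the original module docstring (verbatim there). Namespaces and sections KEPT
(re-opened below exactly as they stand at the cut, with their `open`∕`variable` lines replayed); code bytes = the workfile՚s, docstrings included; options preamble repeated from PART 1.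
HC_CM is proved only modulo the 7 printed citations (2 remaining: hLiu418 = stmt-HodgeConjecture-24832, h413 = stmt-HodgeConjecture-24833) until rung 0 closes; a re-home is count-neutral. -/

namespace Summit.HodgeConjecture.HodgeConjecture.Cruxes.HLiu418.F0D9opRoad2
set_option linter.dupNamespace false  -- `Summit.HodgeConjecture.HodgeConjecture.…` BY DESIGN (D-0017), as in `Lines/d6_cm_curve.lean`
open CategoryTheory NumberField IsDedekindDomain MulAction
open scoped Matrix MonObj CategoryTheory.Obj
open MonoidalCategory
open Summit.HodgeConjecture.CorCM.Lines.A3Liu418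
open Literature.AlgebraicGeometry.Motives (AbelianVariety)
open Literature.AlgebraicGeometry.Motives.AbelianVariety (rationalTateModuleMap frobeniusHom zsmul_eq_zsmul_trace_comp_of_pin
  exists_finite_forall_exists_goodReductionAt_homReduction_tateSpecialisation)
open Literature.NumberTheory.GaloisRepresentations
open Literature.NumberTheory.Automorphic Literature.NumberTheory.Automorphic.UnitaryGroup
open Literature.AlgebraicGeometry.ShimuraVarieties.UnitaryCanonicalModel
open Literature.NumberTheory.Automorphic.Liu2021.AppendixC
open Literature.AlgebraicGeometry.Motives (AlgPoints IntegralModel frobeniusOver SchemeOver)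
open Literature.NumberTheory.DiophantineGeometry (geomResidueField)

section Edition5Desk
open Literature.NumberTheory.EllipticCurves (genericFibre)
open Literature.NumberTheory.DiophantineGeometry (specialFibreFunctor)
open IsLocalRing (closedPoint)


/-- **LETTER Γ3-Q — `HeckeSumReindexing`** (F0P5a-plan (g2) desk letter `Gamma3-RECORD-DESK.v0` ecc63e1c :115, VERBATIM): for
`x ∈ M⋆_N(Ω)`, `N ≤ K`, `K₁ = K ∩ t₁ K t₁⁻¹` and coset representatives `r₁ α` of `K t₁ K ∕ K` as in C3, the `α`-indexed translates
`T_{r₁ α}^{N→K} x` are the images under `T_{t₁}^{K₁→K}` of points `y_α ∈ M⋆_{K₁}(Ω)` lying over `u x ∈ M⋆_K(Ω)`, and EVERY point of the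
`u′`-fibre of `u x` arises (the lift is SURJECTIVE; it is bijective exactly where the fibre is full — ED. 5 uses it at the level `Kc` of
the MOD letter, where clause (7) makes it so by counting).  Record currency (L); INHABITED on the HOME desk `Gamma3Q-PROOF-DESK.v0.F0P5a-p05g3.lean`
263db0a2 (★ p805003 `SepQuotientIntermediateFibres` §4 + the record Hecke laws), REF1 re-homed leg 2a13d569 rc 0.  NOT asserted here.
(print: Liu2021, Lemma C.18 and proof of Cor. D.9 p. 139) (print: Milne2005ShimuraVarieties, §13 p. 118–119) (print: DiamondShurman2005, §5.2) -/
def HeckeSumReindexing : Prop :=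
  ∀ (F : Type) [Field F] [NumberField F] [IsCMField F] [IsGalois ℚ F] (ι₁ : F →+* ℂ)
    (Jstar : Matrix (Fin 2) (Fin 2) F)
    (K₀ : C5.OpenCompactSubgroup ↥(finAdelic ↥(maximalRealSubfield F) F (IsCMField.complexConj F) 2 Jstar))
    (S : RecordSystemGS F Jstar ι₁ K₀) (hU7ₛ : S.HeckeTranslateDefinedOver)
    (hJ : (Jstar.map (IsCMField.complexConj F))ᵀ = Jstar) (hJu : IsUnit Jstar) (K : C5.SmallLevel K₀)
    (w : HeightOneSpectrum (𝓞 F)) (hw : (IsCMField.complexConj F) • w ≠ w)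
    (K₁ : C5.SmallLevel K₀) (hle : K₁ ≤ K)
    (ht : C5.HeckeLE
       (UnitaryGroup.heckeElementAt ↥(maximalRealSubfield F) F (IsCMField.complexConj F) 2 Jstar
           (⟨w, rfl⟩ : UnitaryGroup.PlacesOver F (w.under (𝓞 ↥(maximalRealSubfield F))))
           (IsCMField.complexConj_ne_one F) hJ hw (UnitaryGroup.isUnit_placeForm Jstar hJu w) (HeckeCharacter.uniformizer F w) 1 :
         ↥(finAdelic ↥(maximalRealSubfield F) F (IsCMField.complexConj F) 2 Jstar)) K₁ K)
    (_hK₁ : (K₁.1.1 : Subgroup ↥(finAdelic ↥(maximalRealSubfield F) F (IsCMField.complexConj F) 2 Jstar))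
       = K.1.1 ⊓ (K.1.1).map (MulAut.conj
           (UnitaryGroup.heckeElementAt ↥(maximalRealSubfield F) F (IsCMField.complexConj F) 2 Jstar
             (⟨w, rfl⟩ : UnitaryGroup.PlacesOver F (w.under (𝓞 ↥(maximalRealSubfield F))))
             (IsCMField.complexConj_ne_one F) hJ hw (UnitaryGroup.isUnit_placeForm Jstar hJu w) (HeckeCharacter.uniformizer F w) 1 :
           ↥(finAdelic ↥(maximalRealSubfield F) F (IsCMField.complexConj F) 2 Jstar))).toMonoidHom)
    (N : C5.SmallLevel K₀) (hNK : N ≤ K)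
    (r₁ : orbit (K.1.1 : Subgroup ↥(finAdelic ↥(maximalRealSubfield F) F (IsCMField.complexConj F) 2 Jstar))
         ((UnitaryGroup.heckeElementAt ↥(maximalRealSubfield F) F (IsCMField.complexConj F) 2 Jstar
             (⟨w, rfl⟩ : UnitaryGroup.PlacesOver F (w.under (𝓞 ↥(maximalRealSubfield F))))
             (IsCMField.complexConj_ne_one F) hJ hw (UnitaryGroup.isUnit_placeForm Jstar hJu w) (HeckeCharacter.uniformizer F w) 1 :
           ↥(finAdelic ↥(maximalRealSubfield F) F (IsCMField.complexConj F) 2 Jstar)) :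
           ↥(finAdelic ↥(maximalRealSubfield F) F (IsCMField.complexConj F) 2 Jstar) ⧸
             (K.1.1 : Subgroup ↥(finAdelic ↥(maximalRealSubfield F) F (IsCMField.complexConj F) 2 Jstar))) →
       ↥(finAdelic ↥(maximalRealSubfield F) F (IsCMField.complexConj F) 2 Jstar))
    (_hr₁ : ∀ α, ((r₁ α : ↥(finAdelic ↥(maximalRealSubfield F) F (IsCMField.complexConj F) 2 Jstar)) :
        ↥(finAdelic ↥(maximalRealSubfield F) F (IsCMField.complexConj F) 2 Jstar) ⧸
          (K.1.1 : Subgroup ↥(finAdelic ↥(maximalRealSubfield F) F (IsCMField.complexConj F) 2 Jstar))) = α.1)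
    (hrN₁ : ∀ α, C5.HeckeLE (r₁ α) N K)
    (x : AlgPoints (S.M.obj N) (AlgebraicClosure (w.adicCompletion F))),
    ∃ lift : orbit (K.1.1 : Subgroup ↥(finAdelic ↥(maximalRealSubfield F) F (IsCMField.complexConj F) 2 Jstar))
               ((UnitaryGroup.heckeElementAt ↥(maximalRealSubfield F) F (IsCMField.complexConj F) 2 Jstar
                   (⟨w, rfl⟩ : UnitaryGroup.PlacesOver F (w.under (𝓞 ↥(maximalRealSubfield F))))
                   (IsCMField.complexConj_ne_one F) hJ hw (UnitaryGroup.isUnit_placeForm Jstar hJu w) (HeckeCharacter.uniformizer F w) 1 :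
                 ↥(finAdelic ↥(maximalRealSubfield F) F (IsCMField.complexConj F) 2 Jstar)) :
                 ↥(finAdelic ↥(maximalRealSubfield F) F (IsCMField.complexConj F) 2 Jstar) ⧸
                   (K.1.1 : Subgroup ↥(finAdelic ↥(maximalRealSubfield F) F (IsCMField.complexConj F) 2 Jstar))) →
             {y : AlgPoints (S.M.obj K₁) (AlgebraicClosure (w.adicCompletion F)) //
                AlgPoints.map (S.M.map (homOfLE hle)) y = AlgPoints.map (S.M.map (homOfLE hNK)) x},
      Function.Surjective lift ∧
      ∀ α, AlgPoints.map (recordHeckeTranslateGS S hU7ₛ _ K₁ K ht) (lift α).1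
             = AlgPoints.map (recordHeckeTranslateGS S hU7ₛ (r₁ α) N K (hrN₁ α)) x

/-- **LETTER DEG — `HeckeDegreeSplitPlace`** (generic adelic group theory, the layer of ★ `UnitaryGroupHyperspecialHecke`; F0P5a-p04 (g3)
row (b4) `UnitaryGroupHeckeDegreeSplitPlace.lean`, fileable ★ capital): for a subgroup `K ≤ U(J⋆)(𝔸_{F⁺,f})` hyperspecial-AND-factorisable at
`w|_{F⁺}` (D2 `IsHyperspecialAt`), `w` split with `J⋆_w ∈ GL₂(𝒪_w)`, and `tᵢ = heckeElementAt … (uniformizer F w) i` (`t₁ ↔ diag(ϖ, 1)`,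
`t₂ ↔ diag(ϖ, ϖ)` under `U(J⋆)(F⁺_{w⁺}) ≅ GL₂(F_w)`): (a) the `K`-orbit of `t₁ K` in `G ∕ K` (= `K t₁ K ∕ K`, the index set of C3՚s `r₁`) has
`N w + 1` elements (`GL₂(𝒪_w) diag(ϖ,1) GL₂(𝒪_w) ∕ GL₂(𝒪_w) ≅ ℙ¹(κ(w))`); (b) the `K`-orbit of `t₂ K` is the singleton `{t₂ K}`; (c) `t₂`
normalises `K` (it is central).  M.  NOT asserted here.
(print: Shimura1971, Prop. 3.33 ∕ (3.3.3)) (print: DiamondShurman2005, §5.2 eq. (5.3)) (print: GetzHahn2024, Prop. 2.3.1) -/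
def HeckeDegreeSplitPlace : Prop :=
  ∀ (F : Type) [Field F] [NumberField F] [IsCMField F] [IsGalois ℚ F]
    (Jstar : Matrix (Fin 2) (Fin 2) F)
    (hJ : (Jstar.map (IsCMField.complexConj F))ᵀ = Jstar) (hJu : IsUnit Jstar)
    (K : Subgroup ↥(finAdelic ↥(maximalRealSubfield F) F (IsCMField.complexConj F) 2 Jstar))
    (w : HeightOneSpectrum (𝓞 F)) (hw : (IsCMField.complexConj F) • w ≠ w),
    (UnitaryGroup.isUnit_placeForm Jstar hJu w).unit ∈ glInt 2 (w.adicCompletion F) →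
      UnitaryGroup.IsHyperspecialAt ↥(maximalRealSubfield F) F (IsCMField.complexConj F) 2 Jstar K
        (w.under (𝓞 ↥(maximalRealSubfield F))) →
      Nat.card ↥(orbit K
          ((UnitaryGroup.heckeElementAt ↥(maximalRealSubfield F) F (IsCMField.complexConj F) 2 Jstar
              (⟨w, rfl⟩ : UnitaryGroup.PlacesOver F (w.under (𝓞 ↥(maximalRealSubfield F))))
              (IsCMField.complexConj_ne_one F) hJ hw (UnitaryGroup.isUnit_placeForm Jstar hJu w) (HeckeCharacter.uniformizer F w) 1 :
            ↥(finAdelic ↥(maximalRealSubfield F) F (IsCMField.complexConj F) 2 Jstar)) :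
            ↥(finAdelic ↥(maximalRealSubfield F) F (IsCMField.complexConj F) 2 Jstar) ⧸ K))
        = Ideal.absNorm w.asIdeal + 1 ∧
      (∀ α : ↥(orbit K
          ((UnitaryGroup.heckeElementAt ↥(maximalRealSubfield F) F (IsCMField.complexConj F) 2 Jstar
              (⟨w, rfl⟩ : UnitaryGroup.PlacesOver F (w.under (𝓞 ↥(maximalRealSubfield F))))
              (IsCMField.complexConj_ne_one F) hJ hw (UnitaryGroup.isUnit_placeForm Jstar hJu w) (HeckeCharacter.uniformizer F w) 2 :
            ↥(finAdelic ↥(maximalRealSubfield F) F (IsCMField.complexConj F) 2 Jstar)) :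
            ↥(finAdelic ↥(maximalRealSubfield F) F (IsCMField.complexConj F) 2 Jstar) ⧸ K)),
        (α.1 : ↥(finAdelic ↥(maximalRealSubfield F) F (IsCMField.complexConj F) 2 Jstar) ⧸ K)
          = ((UnitaryGroup.heckeElementAt ↥(maximalRealSubfield F) F (IsCMField.complexConj F) 2 Jstar
              (⟨w, rfl⟩ : UnitaryGroup.PlacesOver F (w.under (𝓞 ↥(maximalRealSubfield F))))
              (IsCMField.complexConj_ne_one F) hJ hw (UnitaryGroup.isUnit_placeForm Jstar hJu w) (HeckeCharacter.uniformizer F w) 2 :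
            ↥(finAdelic ↥(maximalRealSubfield F) F (IsCMField.complexConj F) 2 Jstar)) :
            ↥(finAdelic ↥(maximalRealSubfield F) F (IsCMField.complexConj F) 2 Jstar) ⧸ K)) ∧
      (∀ k ∈ K,
        (UnitaryGroup.heckeElementAt ↥(maximalRealSubfield F) F (IsCMField.complexConj F) 2 Jstar
            (⟨w, rfl⟩ : UnitaryGroup.PlacesOver F (w.under (𝓞 ↥(maximalRealSubfield F))))
            (IsCMField.complexConj_ne_one F) hJ hw (UnitaryGroup.isUnit_placeForm Jstar hJu w) (HeckeCharacter.uniformizer F w) 2 :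
          ↥(finAdelic ↥(maximalRealSubfield F) F (IsCMField.complexConj F) 2 Jstar))⁻¹ * k *
        (UnitaryGroup.heckeElementAt ↥(maximalRealSubfield F) F (IsCMField.complexConj F) 2 Jstar
            (⟨w, rfl⟩ : UnitaryGroup.PlacesOver F (w.under (𝓞 ↥(maximalRealSubfield F))))
            (IsCMField.complexConj_ne_one F) hJ hw (UnitaryGroup.isUnit_placeForm Jstar hJu w) (HeckeCharacter.uniformizer F w) 2 :
          ↥(finAdelic ↥(maximalRealSubfield F) F (IsCMField.complexConj F) 2 Jstar)) ∈ K)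

/-- **LETTER DESC — `HeckeMultisetLevelDescent`** (record currency, F0P5a-p05 (g3) row (b5) HOME desk; the coset bijection is generic =
F0P5a-p02 (g3) row (b6) `UnitaryGroupHeckeCosetLevelChange.lean`): for two small levels `Kc ≤ K`, BOTH hyperspecial-factorisable at the split
place `w|_{F⁺}`, every `N ≤ K`, C3-families `r₁`, `r₂` of representatives of `K t₁ K ∕ K`, `K t₂ K ∕ K` admissible at `N`, and every
`x ∈ M⋆_N(Ω)`: there are a deeper small level `N′ ≤ N`, `N′ ≤ Kc`, a lift `x′ ∈ M⋆_{N′}(Ω)` of `x`, C3-families `r̃₁`, `r̃₂` AT LEVEL `Kc`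
admissible at `N′`, and bijections `eᵢ : K tᵢ K ∕ K ≃ Kc tᵢ Kc ∕ Kc` along which the level-`K` translates of `x` are the `u_{Kc→K}`-images of
the level-`Kc` translates of `x′`: `T^{N→K}_{rᵢ α} x = u_{Kc→K} (T^{N′→Kc}_{r̃ᵢ (eᵢ α)} x′)`.  ROAD: `N′` normal in `K` inside
`N ⊓ Kc ⊓ ⋂ (r̃ β) Kc (r̃ β)⁻¹`; `x′` by ★ `IsSepQuotient.surjective_map_geometric_of_finiteIndex` (p805003); `r̃ (e α) := k_{α,w} · tᵢ` with
`k_{α,w}` the re-embedded `w`-component of a representative (`IsHyperspecialAt` (D2) factorisation; `tᵢ` commutes with elements trivial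
at `w`); then the record Hecke laws (★ `isHeckeTranslate_comp`, `heckeTranslate_unique`, `isHeckeTranslate_id_of_mem`).  M.  NOT asserted here.
(print: Milne2005ShimuraVarieties, §5 p. 57–58 and Thm. 13.6) (print: Liu2021, §4.2 l. 2060–2074 and Lemma C.18) -/
def HeckeMultisetLevelDescent : Prop :=
  ∀ (F : Type) [Field F] [NumberField F] [IsCMField F] [IsGalois ℚ F] (ι₁ : F →+* ℂ)
    (Jstar : Matrix (Fin 2) (Fin 2) F)
    (K₀ : C5.OpenCompactSubgroup ↥(finAdelic ↥(maximalRealSubfield F) F (IsCMField.complexConj F) 2 Jstar))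
    (S : RecordSystemGS F Jstar ι₁ K₀) (hU7ₛ : S.HeckeTranslateDefinedOver)
    (hJ : (Jstar.map (IsCMField.complexConj F))ᵀ = Jstar) (hJu : IsUnit Jstar) (K : C5.SmallLevel K₀)
    (w : HeightOneSpectrum (𝓞 F)) (hw : (IsCMField.complexConj F) • w ≠ w),
    (UnitaryGroup.isUnit_placeForm Jstar hJu w).unit ∈ glInt 2 (w.adicCompletion F) →
      UnitaryGroup.IsHyperspecialAt ↥(maximalRealSubfield F) F (IsCMField.complexConj F) 2 Jstar K.1.1
        (w.under (𝓞 ↥(maximalRealSubfield F))) →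
      ∀ (Kc : C5.SmallLevel K₀) (hKcK : Kc ≤ K),
      UnitaryGroup.IsHyperspecialAt ↥(maximalRealSubfield F) F (IsCMField.complexConj F) 2 Jstar Kc.1.1
        (w.under (𝓞 ↥(maximalRealSubfield F))) →
      ∀ (N : C5.SmallLevel K₀) (hNK : N ≤ K)
        (r₁ : orbit (K.1.1 : Subgroup ↥(finAdelic ↥(maximalRealSubfield F) F (IsCMField.complexConj F) 2 Jstar))
             ((UnitaryGroup.heckeElementAt ↥(maximalRealSubfield F) F (IsCMField.complexConj F) 2 Jstar
                 (⟨w, rfl⟩ : UnitaryGroup.PlacesOver F (w.under (𝓞 ↥(maximalRealSubfield F))))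
                 (IsCMField.complexConj_ne_one F) hJ hw (UnitaryGroup.isUnit_placeForm Jstar hJu w) (HeckeCharacter.uniformizer F w) 1 :
               ↥(finAdelic ↥(maximalRealSubfield F) F (IsCMField.complexConj F) 2 Jstar)) :
               ↥(finAdelic ↥(maximalRealSubfield F) F (IsCMField.complexConj F) 2 Jstar) ⧸
                 (K.1.1 : Subgroup ↥(finAdelic ↥(maximalRealSubfield F) F (IsCMField.complexConj F) 2 Jstar))) →
           ↥(finAdelic ↥(maximalRealSubfield F) F (IsCMField.complexConj F) 2 Jstar))
        (_hr₁ : ∀ α, ((r₁ α : ↥(finAdelic ↥(maximalRealSubfield F) F (IsCMField.complexConj F) 2 Jstar)) :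
            ↥(finAdelic ↥(maximalRealSubfield F) F (IsCMField.complexConj F) 2 Jstar) ⧸
              (K.1.1 : Subgroup ↥(finAdelic ↥(maximalRealSubfield F) F (IsCMField.complexConj F) 2 Jstar))) = α.1)
        (hrN₁ : ∀ α, C5.HeckeLE (r₁ α) N K)
        (r₂ : orbit (K.1.1 : Subgroup ↥(finAdelic ↥(maximalRealSubfield F) F (IsCMField.complexConj F) 2 Jstar))
             ((UnitaryGroup.heckeElementAt ↥(maximalRealSubfield F) F (IsCMField.complexConj F) 2 Jstar
                 (⟨w, rfl⟩ : UnitaryGroup.PlacesOver F (w.under (𝓞 ↥(maximalRealSubfield F))))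
                 (IsCMField.complexConj_ne_one F) hJ hw (UnitaryGroup.isUnit_placeForm Jstar hJu w) (HeckeCharacter.uniformizer F w) 2 :
               ↥(finAdelic ↥(maximalRealSubfield F) F (IsCMField.complexConj F) 2 Jstar)) :
               ↥(finAdelic ↥(maximalRealSubfield F) F (IsCMField.complexConj F) 2 Jstar) ⧸
                 (K.1.1 : Subgroup ↥(finAdelic ↥(maximalRealSubfield F) F (IsCMField.complexConj F) 2 Jstar))) →
           ↥(finAdelic ↥(maximalRealSubfield F) F (IsCMField.complexConj F) 2 Jstar))
        (_hr₂ : ∀ α, ((r₂ α : ↥(finAdelic ↥(maximalRealSubfield F) F (IsCMField.complexConj F) 2 Jstar)) :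
            ↥(finAdelic ↥(maximalRealSubfield F) F (IsCMField.complexConj F) 2 Jstar) ⧸
              (K.1.1 : Subgroup ↥(finAdelic ↥(maximalRealSubfield F) F (IsCMField.complexConj F) 2 Jstar))) = α.1)
        (hrN₂ : ∀ α, C5.HeckeLE (r₂ α) N K)
        (x : AlgPoints (S.M.obj N) (AlgebraicClosure (w.adicCompletion F))),
      ∃ (N' : C5.SmallLevel K₀) (hN'N : N' ≤ N) (_hN'Kc : N' ≤ Kc)
        (x' : AlgPoints (S.M.obj N') (AlgebraicClosure (w.adicCompletion F)))
        (_hx' : AlgPoints.map (S.M.map (homOfLE hN'N)) x' = x)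
        (rc₁ : orbit (Kc.1.1 : Subgroup ↥(finAdelic ↥(maximalRealSubfield F) F (IsCMField.complexConj F) 2 Jstar))
             ((UnitaryGroup.heckeElementAt ↥(maximalRealSubfield F) F (IsCMField.complexConj F) 2 Jstar
                 (⟨w, rfl⟩ : UnitaryGroup.PlacesOver F (w.under (𝓞 ↥(maximalRealSubfield F))))
                 (IsCMField.complexConj_ne_one F) hJ hw (UnitaryGroup.isUnit_placeForm Jstar hJu w) (HeckeCharacter.uniformizer F w) 1 :
               ↥(finAdelic ↥(maximalRealSubfield F) F (IsCMField.complexConj F) 2 Jstar)) :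
               ↥(finAdelic ↥(maximalRealSubfield F) F (IsCMField.complexConj F) 2 Jstar) ⧸
                 (Kc.1.1 : Subgroup ↥(finAdelic ↥(maximalRealSubfield F) F (IsCMField.complexConj F) 2 Jstar))) →
           ↥(finAdelic ↥(maximalRealSubfield F) F (IsCMField.complexConj F) 2 Jstar))
        (_hrc₁ : ∀ β, ((rc₁ β : ↥(finAdelic ↥(maximalRealSubfield F) F (IsCMField.complexConj F) 2 Jstar)) :
            ↥(finAdelic ↥(maximalRealSubfield F) F (IsCMField.complexConj F) 2 Jstar) ⧸
              (Kc.1.1 : Subgroup ↥(finAdelic ↥(maximalRealSubfield F) F (IsCMField.complexConj F) 2 Jstar))) = β.1)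
        (hrcN₁ : ∀ β, C5.HeckeLE (rc₁ β) N' Kc)
        (rc₂ : orbit (Kc.1.1 : Subgroup ↥(finAdelic ↥(maximalRealSubfield F) F (IsCMField.complexConj F) 2 Jstar))
             ((UnitaryGroup.heckeElementAt ↥(maximalRealSubfield F) F (IsCMField.complexConj F) 2 Jstar
                 (⟨w, rfl⟩ : UnitaryGroup.PlacesOver F (w.under (𝓞 ↥(maximalRealSubfield F))))
                 (IsCMField.complexConj_ne_one F) hJ hw (UnitaryGroup.isUnit_placeForm Jstar hJu w) (HeckeCharacter.uniformizer F w) 2 :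
               ↥(finAdelic ↥(maximalRealSubfield F) F (IsCMField.complexConj F) 2 Jstar)) :
               ↥(finAdelic ↥(maximalRealSubfield F) F (IsCMField.complexConj F) 2 Jstar) ⧸
                 (Kc.1.1 : Subgroup ↥(finAdelic ↥(maximalRealSubfield F) F (IsCMField.complexConj F) 2 Jstar))) →
           ↥(finAdelic ↥(maximalRealSubfield F) F (IsCMField.complexConj F) 2 Jstar))
        (_hrc₂ : ∀ β, ((rc₂ β : ↥(finAdelic ↥(maximalRealSubfield F) F (IsCMField.complexConj F) 2 Jstar)) :
            ↥(finAdelic ↥(maximalRealSubfield F) F (IsCMField.complexConj F) 2 Jstar) ⧸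
              (Kc.1.1 : Subgroup ↥(finAdelic ↥(maximalRealSubfield F) F (IsCMField.complexConj F) 2 Jstar))) = β.1)
        (hrcN₂ : ∀ β, C5.HeckeLE (rc₂ β) N' Kc)
        (e₁ : ↥(orbit (K.1.1 : Subgroup ↥(finAdelic ↥(maximalRealSubfield F) F (IsCMField.complexConj F) 2 Jstar))
                 ((UnitaryGroup.heckeElementAt ↥(maximalRealSubfield F) F (IsCMField.complexConj F) 2 Jstar
                     (⟨w, rfl⟩ : UnitaryGroup.PlacesOver F (w.under (𝓞 ↥(maximalRealSubfield F))))
                     (IsCMField.complexConj_ne_one F) hJ hw (UnitaryGroup.isUnit_placeForm Jstar hJu w) (HeckeCharacter.uniformizer F w) 1 :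
                   ↥(finAdelic ↥(maximalRealSubfield F) F (IsCMField.complexConj F) 2 Jstar)) :
                   ↥(finAdelic ↥(maximalRealSubfield F) F (IsCMField.complexConj F) 2 Jstar) ⧸
                     (K.1.1 : Subgroup ↥(finAdelic ↥(maximalRealSubfield F) F (IsCMField.complexConj F) 2 Jstar)))) ≃
              ↥(orbit (Kc.1.1 : Subgroup ↥(finAdelic ↥(maximalRealSubfield F) F (IsCMField.complexConj F) 2 Jstar))
                 ((UnitaryGroup.heckeElementAt ↥(maximalRealSubfield F) F (IsCMField.complexConj F) 2 Jstar
                     (⟨w, rfl⟩ : UnitaryGroup.PlacesOver F (w.under (𝓞 ↥(maximalRealSubfield F))))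
                     (IsCMField.complexConj_ne_one F) hJ hw (UnitaryGroup.isUnit_placeForm Jstar hJu w) (HeckeCharacter.uniformizer F w) 1 :
                   ↥(finAdelic ↥(maximalRealSubfield F) F (IsCMField.complexConj F) 2 Jstar)) :
                   ↥(finAdelic ↥(maximalRealSubfield F) F (IsCMField.complexConj F) 2 Jstar) ⧸
                     (Kc.1.1 : Subgroup ↥(finAdelic ↥(maximalRealSubfield F) F (IsCMField.complexConj F) 2 Jstar)))))
        (e₂ : ↥(orbit (K.1.1 : Subgroup ↥(finAdelic ↥(maximalRealSubfield F) F (IsCMField.complexConj F) 2 Jstar))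
                 ((UnitaryGroup.heckeElementAt ↥(maximalRealSubfield F) F (IsCMField.complexConj F) 2 Jstar
                     (⟨w, rfl⟩ : UnitaryGroup.PlacesOver F (w.under (𝓞 ↥(maximalRealSubfield F))))
                     (IsCMField.complexConj_ne_one F) hJ hw (UnitaryGroup.isUnit_placeForm Jstar hJu w) (HeckeCharacter.uniformizer F w) 2 :
                   ↥(finAdelic ↥(maximalRealSubfield F) F (IsCMField.complexConj F) 2 Jstar)) :
                   ↥(finAdelic ↥(maximalRealSubfield F) F (IsCMField.complexConj F) 2 Jstar) ⧸
                     (K.1.1 : Subgroup ↥(finAdelic ↥(maximalRealSubfield F) F (IsCMField.complexConj F) 2 Jstar)))) ≃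
              ↥(orbit (Kc.1.1 : Subgroup ↥(finAdelic ↥(maximalRealSubfield F) F (IsCMField.complexConj F) 2 Jstar))
                 ((UnitaryGroup.heckeElementAt ↥(maximalRealSubfield F) F (IsCMField.complexConj F) 2 Jstar
                     (⟨w, rfl⟩ : UnitaryGroup.PlacesOver F (w.under (𝓞 ↥(maximalRealSubfield F))))
                     (IsCMField.complexConj_ne_one F) hJ hw (UnitaryGroup.isUnit_placeForm Jstar hJu w) (HeckeCharacter.uniformizer F w) 2 :
                   ↥(finAdelic ↥(maximalRealSubfield F) F (IsCMField.complexConj F) 2 Jstar)) :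
                   ↥(finAdelic ↥(maximalRealSubfield F) F (IsCMField.complexConj F) 2 Jstar) ⧸
                     (Kc.1.1 : Subgroup ↥(finAdelic ↥(maximalRealSubfield F) F (IsCMField.complexConj F) 2 Jstar))))),
        (∀ α, AlgPoints.map (recordHeckeTranslateGS S hU7ₛ (r₁ α) N K (hrN₁ α)) x
            = AlgPoints.map (S.M.map (homOfLE hKcK))
                (AlgPoints.map (recordHeckeTranslateGS S hU7ₛ (rc₁ (e₁ α)) N' Kc (hrcN₁ (e₁ α))) x')) ∧
        (∀ α, AlgPoints.map (recordHeckeTranslateGS S hU7ₛ (r₂ α) N K (hrN₂ α)) x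
            = AlgPoints.map (S.M.map (homOfLE hKcK))
                (AlgPoints.map (recordHeckeTranslateGS S hU7ₛ (rc₂ (e₂ α)) N' Kc (hrcN₂ (e₂ α))) x'))

end Edition5Desk
end Summit.HodgeConjecture.HodgeConjecture.Cruxes.HLiu418.F0D9opRoad2
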